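import Mathlib
import Summits.AtomisticToContinuum.Crystallization.Theses.PhononSlackCertificates
import Summits.AtomisticToContinuum.Crystallization.Theorems.LayeredLawsSelectHcp.Negative.FccLattice
import Literature.MathematicalPhysics.StatisticalMechanics.LennardJonesClusters
import Literature.Geometry.DiscreteGeometry.TwoShellPatterns

/-!
# Crux `PhononSlackCertificates.NearFarGlueR` (stmt-AtomisticToContinuum-14970), line `Sketch`:
two-shell geometry of the fcc lattice — a bad lattice particle owns a vacant site

Continuation lead c1; part 1 of 2 of the LATTICE-SUBSET COERCIVITY theorem
(`PhononSlackCertificatesNearFarGlueRLatticeSubset.lean`): for particles drawn from the fcc lattice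
`fccD3 a` (`a ∈ [47/50, 1]`, the tree's `LayeredLawsSelectHcp.Negative.FccLattice.fccD3`),

* `twoShell_fccD3` — the non-zero lattice points of norm `≤ 3a/2` are exactly the `18` scaled
  two-shell sites `cs a • intVec v`, `v ∈ fccInt ∪ fccSecondShellInt` (norms `a`, `√2·a`);
* `good_of_sites_occupied` — a particle all of whose `18` sites are occupied is `1/20`-good (exact
  match, identity isometry, fcc pattern; the two-way clause by `twoShell_fccD3`);
* `exists_vacant_site_of_bad` / registered sub-goal `stub_latticeShell` — hence a BAD lattice
  particle has a vacant two-shell site;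
* `lennardJones_site_le` — and the missing bond to it is worth at least `15/768 = |V_LJ(√2)|`
  (`V_LJ(a) ≤ −0.066`, `V_LJ(√2 a) ≤ V_LJ(√2)`), while every lattice bond is attractive
  (`lennardJones_nonpos_of_ge`: `V_LJ ≤ 0` from `47/50` on).
-/

noncomputable section

namespace Summit.AtomisticToContinuum.Crystallization.Theorems.PhononSlackCertificatesNearFarGlueR

open Literature.MathematicalPhysics.StatisticalMechanics
open Literature.Geometry.DiscreteGeometry
open Summit.AtomisticToContinuum.Crystallization.Theses.PhononSlackCertificates
open Summit.AtomisticToContinuum.Crystallization.Theorems.LayeredLawsSelectHcp.Negative.IntegerForms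
  (even_sqNormInt two_le_sqNormInt mem_fccInt_of_sqNormInt even_of_mem_fccInt norm_smul_intVec
    intVec_zero)
open Summit.AtomisticToContinuum.Crystallization.Theorems.LayeredLawsSelectHcp.Negative.FccLattice
  (cs cs_pos cs_mul_sqrt_two cs_sq fccD3 mem_fccD3 le_dist_of_mem_fccD3)
open scoped BigOperators

/-! ## §1 The two-shell of the fcc lattice -/

/-- The integer vectors of squared norm `4` are the six second-shell vectors `(±2,0,0)` and
permutations. [folklore] -/
theorem mem_fccSecondShellInt_of_sqNormInt {v : Fin 3 → ℤ} (h : sqNormInt v = 4) :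
    v ∈ fccSecondShellInt := by
  have hv : v = ![v 0, v 1, v 2] := by
    funext l; fin_cases l <;> rfl
  set p := v 0 with hp
  set q := v 1 with hq
  set r := v 2 with hr
  rw [hv] at h ⊢
  simp only [sqNormInt, Matrix.cons_val_zero, Matrix.cons_val_one, Matrix.cons_val_two,
    Matrix.tail_cons, Matrix.head_cons] at h
  have hp2 : p ^ 2 ≤ 4 := by nlinarith [sq_nonneg q, sq_nonneg r]
  have hq2 : q ^ 2 ≤ 4 := by nlinarith [sq_nonneg p, sq_nonneg r]
  have hr2 : r ^ 2 ≤ 4 := by nlinarith [sq_nonneg p, sq_nonneg q]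
  have hp1 : -2 ≤ p ∧ p ≤ 2 := by constructor <;> nlinarith
  have hq1 : -2 ≤ q ∧ q ≤ 2 := by constructor <;> nlinarith
  have hr1 : -2 ≤ r ∧ r ≤ 2 := by constructor <;> nlinarith
  obtain ⟨hp1, hp1'⟩ := hp1
  obtain ⟨hq1, hq1'⟩ := hq1
  obtain ⟨hr1, hr1'⟩ := hr1
  clear_value p q r
  interval_cases p <;> interval_cases q <;> interval_cases r <;> first | decide | (norm_num at h)

/-- Second-shell vectors have even coordinate sum. [folklore] -/
theorem even_of_mem_fccSecondShellInt : ∀ v ∈ fccSecondShellInt, Even (v 0 + v 1 + v 2) := by decide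

/-- Squared norms on the two shells. [folklore] -/
theorem sqNormInt_of_mem_twoShellInt {v : Fin 3 → ℤ} (hv : v ∈ fccInt ∪ fccSecondShellInt) :
    sqNormInt v = 2 ∨ sqNormInt v = 4 :=
  sqNormInt_fccTwoShellInt v hv

/-- Two-shell vectors have even coordinate sum. [folklore] -/
theorem even_of_mem_twoShellInt {v : Fin 3 → ℤ} (hv : v ∈ fccInt ∪ fccSecondShellInt) :
    Even (v 0 + v 1 + v 2) := by
  rcases Finset.mem_union.1 hv with h | h
  · exact even_of_mem_fccInt v h
  · exact even_of_mem_fccSecondShellInt v h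

/-- **The `3/2`-shell of the origin in `fccD3 a` is the scaled two-shell pattern**: a non-zero
lattice point of norm `≤ 3a/2` is `cs a • intVec v` with `v` on the first or second shell. [folklore] -/
theorem twoShell_fccD3 {a : ℝ} (ha : 0 < a) {z : (EuclideanSpace ℝ (Fin 3))} (hz : z ∈ (fccD3 a : Set (EuclideanSpace ℝ (Fin 3)))) (hne : z ≠ 0)
    (hle : ‖z‖ ≤ 3 / 2 * a) : ∃ v ∈ fccInt ∪ fccSecondShellInt, z = cs a • intVec v := by
  obtain ⟨v, hv, rfl⟩ := hz
  refine ⟨v, ?_, rfl⟩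
  have hv0 : v ≠ 0 := by
    rintro rfl; exact hne (by rw [intVec_zero, smul_zero])
  have h2 := two_le_sqNormInt hv0 hv
  rw [norm_smul_intVec, abs_of_pos (cs_pos ha)] at hle
  have hs0 : (0 : ℝ) ≤ sqNormInt v := by exact_mod_cast (by omega : (0 : ℤ) ≤ sqNormInt v)
  have h4 : (cs a * Real.sqrt (sqNormInt v)) ^ 2 ≤ (3 / 2 * a) ^ 2 :=
    pow_le_pow_left₀ (mul_nonneg (cs_pos ha).le (Real.sqrt_nonneg _)) hle 2
  rw [mul_pow, Real.sq_sqrt hs0, cs_sq] at h4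
  have h5 : (sqNormInt v : ℝ) < 5 := by nlinarith
  have h6 : sqNormInt v < 5 := by exact_mod_cast h5
  rcases even_sqNormInt hv with ⟨m, hm⟩
  have hs : sqNormInt v = 2 ∨ sqNormInt v = 4 := by omega
  rcases hs with hs | hs
  · exact Finset.mem_union_left _ (mem_fccInt_of_sqNormInt hs)
  · exact Finset.mem_union_right _ (mem_fccSecondShellInt_of_sqNormInt hs)

/-- Scaling the pattern point `v/√2` by `a` gives the lattice vector `cs a • intVec v`. [folklore] -/
theorem smul_patternPt (a : ℝ) (v : Fin 3 → ℤ) :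
    a • ((Real.sqrt (2 : ℕ))⁻¹ • intVec v : (EuclideanSpace ℝ (Fin 3))) = cs a • intVec v := by
  rw [smul_smul]
  simp [cs]

/-- The norm of a site vector: `a` on the first shell, `√2·a` on the second. [folklore] -/
theorem norm_site {a : ℝ} (ha : 0 < a) {v : Fin 3 → ℤ} (hv : v ∈ fccInt ∪ fccSecondShellInt) :
    ‖cs a • intVec v‖ = a ∨ ‖cs a • intVec v‖ = Real.sqrt 2 * a := by
  rw [norm_smul_intVec, abs_of_pos (cs_pos ha)]
  rcases sqNormInt_of_mem_twoShellInt hv with h | h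
  · left
    rw [h]; push_cast
    exact cs_mul_sqrt_two a
  · right
    rw [h]; push_cast
    have h4 : Real.sqrt (4 : ℝ) = Real.sqrt 2 * Real.sqrt 2 := by
      rw [← Real.sqrt_mul (by norm_num : (0:ℝ) ≤ 2)]; norm_num
    rw [h4, ← mul_assoc, cs_mul_sqrt_two, mul_comm]

/-- Site vectors are non-zero. [folklore] -/
theorem site_ne_zero {a : ℝ} (ha : 0 < a) {v : Fin 3 → ℤ} (hv : v ∈ fccInt ∪ fccSecondShellInt) :
    cs a • intVec v ≠ (0 : (EuclideanSpace ℝ (Fin 3))) := by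
  intro h
  have hn : ‖cs a • intVec v‖ = 0 := by rw [h, norm_zero]
  rcases norm_site ha hv with h1 | h1
  · rw [h1] at hn; linarith
  · rw [h1] at hn
    have : 0 < Real.sqrt 2 * a := by positivity
    linarith

/-- A site vector added to a lattice point is a lattice point. [folklore] -/
theorem add_site_mem_fccD3 {a : ℝ} {p : (EuclideanSpace ℝ (Fin 3))} (hp : p ∈ (fccD3 a : Set (EuclideanSpace ℝ (Fin 3)))) {v : Fin 3 → ℤ}
    (hv : v ∈ fccInt ∪ fccSecondShellInt) : p + cs a • intVec v ∈ (fccD3 a : Set (EuclideanSpace ℝ (Fin 3))) :=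
  (fccD3 a).add_mem hp ⟨v, even_of_mem_twoShellInt hv, rfl⟩

/-! ## §2 A fully surrounded lattice particle is exactly good -/

/-- **Goodness of a fully surrounded lattice particle.**  If the particles sit on `fccD3 a`
(`a ∈ [47/50, 1]`, distinct) and all `18` two-shell sites of particle `i` are occupied, then `i` is
`1/20`-good: exact match at scale `a` with the identity isometry and the fcc pattern; the two-way
clause holds because the lattice points within `3a/2` of `x i` are exactly the `18` sites
(`twoShell_fccD3`). [folklore] -/
theorem good_of_sites_occupied {a : ℝ} (h47 : 47 / 50 ≤ a) (h1 : a ≤ 1) {N : ℕ} {x : Fin N → (EuclideanSpace ℝ (Fin 3))}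
    (hx : Function.Injective x) (hL : ∀ j, x j ∈ (fccD3 a : Set (EuclideanSpace ℝ (Fin 3)))) (i : Fin N)
    (hocc : ∀ v ∈ fccInt ∪ fccSecondShellInt, ∃ j, x j = x i + cs a • intVec v) :
    IsTwoShellGood (1 / 20) (47 / 50) 1 x i := by
  classical
  have ha : 0 < a := by linarith
  -- the assignment: the occupant of the site, if any
  let f : (EuclideanSpace ℝ (Fin 3)) → Fin N := fun w => if h : ∃ j, x j = x i + a • w then h.choose else i
  have hf : ∀ w : (EuclideanSpace ℝ (Fin 3)), ∀ j, x j = x i + a • w → f w = j ∧ x (f w) = x i + a • w := by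
    intro w j hj
    have hex : ∃ j, x j = x i + a • w := ⟨j, hj⟩
    have hfw : f w = hex.choose := dif_pos hex
    have hspec : x hex.choose = x i + a • w := hex.choose_spec
    refine ⟨?_, by rw [hfw]; exact hspec⟩
    rw [hfw]
    exact hx (hspec.trans hj.symm)
  refine ⟨a, h47, h1, LinearIsometry.id, fccTwoShellPattern, f, Or.inl rfl, ?_, ?_, ?_⟩
  · -- every pattern point is matched exactly by a particle other than `i`
    intro w hw
    obtain ⟨v, hv, rfl⟩ := Finset.mem_image.1 hw
    obtain ⟨j, hj⟩ := hocc v hv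
    rw [← smul_patternPt a v] at hj
    obtain ⟨hfj, hxf⟩ := hf _ j hj
    refine ⟨?_, ?_⟩
    · intro hfi
      have h0 : a • ((Real.sqrt (2 : ℕ))⁻¹ • intVec v : (EuclideanSpace ℝ (Fin 3))) = 0 := by
        have := hxf
        rw [hfi] at this
        exact (add_eq_left.mp this.symm)
      rw [smul_patternPt] at h0
      exact site_ne_zero ha hv h0
    · rw [hxf, LinearIsometry.id_apply, dist_self]
      positivity
  · -- injectivity on the pattern
    intro w hw w' hw' hww'
    obtain ⟨v, hv, rfl⟩ := Finset.mem_image.1 hw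
    obtain ⟨v', hv', rfl⟩ := Finset.mem_image.1 hw'
    obtain ⟨j, hj⟩ := hocc v hv
    obtain ⟨j', hj'⟩ := hocc v' hv'
    rw [← smul_patternPt a v] at hj
    rw [← smul_patternPt a v'] at hj'
    have e1 := (hf _ j hj).2
    have e2 := (hf _ j' hj').2
    have : x i + a • ((Real.sqrt (2 : ℕ))⁻¹ • intVec v : (EuclideanSpace ℝ (Fin 3))) =
        x i + a • ((Real.sqrt (2 : ℕ))⁻¹ • intVec v' : (EuclideanSpace ℝ (Fin 3))) := by
      rw [← e1, ← e2, hww']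
    have h2 := add_left_cancel this
    exact smul_right_injective (EuclideanSpace ℝ (Fin 3)) ha.ne' h2
  · -- two-way: every particle within `3a/2` is a site occupant
    intro j hji hd
    have hz : x j - x i ∈ (fccD3 a : Set (EuclideanSpace ℝ (Fin 3))) := (fccD3 a).sub_mem (hL j) (hL i)
    have hne : x j - x i ≠ 0 := fun h => hji (hx (sub_eq_zero.1 h))
    have hle : ‖x j - x i‖ ≤ 3 / 2 * a := by rwa [← dist_eq_norm]
    obtain ⟨v, hv, hv'⟩ := twoShell_fccD3 ha hz hne hle
    refine ⟨(Real.sqrt (2 : ℕ))⁻¹ • intVec v, Finset.mem_image_of_mem _ hv, ?_⟩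
    have hj : x j = x i + a • ((Real.sqrt (2 : ℕ))⁻¹ • intVec v : (EuclideanSpace ℝ (Fin 3))) := by
      rw [smul_patternPt, ← hv']; abel
    exact (hf _ j hj).1

/-- Contrapositive: a BAD lattice particle has a vacant two-shell site. [folklore] -/
theorem exists_vacant_site_of_bad {a : ℝ} (h47 : 47 / 50 ≤ a) (h1 : a ≤ 1) {N : ℕ}
    {x : Fin N → (EuclideanSpace ℝ (Fin 3))} (hx : Function.Injective x) (hL : ∀ j, x j ∈ (fccD3 a : Set (EuclideanSpace ℝ (Fin 3)))) (i : Fin N)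
    (hbad : ¬ IsTwoShellGood (1 / 20) (47 / 50) 1 x i) :
    ∃ v ∈ fccInt ∪ fccSecondShellInt, x i + cs a • intVec v ∉ Set.range x := by
  by_contra h
  push Not at h
  exact hbad (good_of_sites_occupied h47 h1 hx hL i fun v hv => by
    obtain ⟨j, hj⟩ := h v hv
    exact ⟨j, hj⟩)

/-! ## §3 Lennard-Jones values at the lattice distances -/

/-- `V_LJ(√2·a) ≤ V_LJ(√2)` on the window `a ∈ [47/50, 1]` (`V_LJ` is increasing on `[1, ∞)` and
`1 ≤ √2·a ≤ √2`; the monotonicity step is that of `NearFarGlueRNegative.lennardJones_mono_of_one_le`).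
[folklore] -/
theorem lennardJones_sqrt_two_mul_le {a : ℝ} (h47 : 47 / 50 ≤ a) (h1 : a ≤ 1) :
    lennardJones (Real.sqrt 2 * a) ≤ lennardJones (Real.sqrt 2) := by
  have hs : (1.41 : ℝ) ≤ Real.sqrt 2 := by
    rw [show (1.41 : ℝ) = Real.sqrt (1.41 ^ 2) from (Real.sqrt_sq (by norm_num)).symm]
    exact Real.sqrt_le_sqrt (by norm_num)
  have hs2 : 0 ≤ Real.sqrt 2 := Real.sqrt_nonneg 2
  have hs1 : (1 : ℝ) ≤ Real.sqrt 2 * a := by nlinarith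
  have hst : Real.sqrt 2 * a ≤ Real.sqrt 2 := by nlinarith
  unfold lennardJones
  have hs0 : 0 < Real.sqrt 2 * a := by linarith
  have ht0 : 0 < Real.sqrt 2 := by linarith
  set u : ℝ := ((Real.sqrt 2 * a)⁻¹) ^ 6 with hu
  set v : ℝ := ((Real.sqrt 2)⁻¹) ^ 6 with hv
  have hu1 : u ≤ 1 := by
    rw [hu]; exact pow_le_one₀ (inv_nonneg.2 hs0.le) (inv_le_one_of_one_le₀ hs1)
  have hv0 : 0 ≤ v := by positivity
  have hvu : v ≤ u := pow_le_pow_left₀ (inv_nonneg.2 ht0.le) (inv_anti₀ hs0 hst) 6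
  have h12s : ((Real.sqrt 2 * a)⁻¹) ^ 12 = u ^ 2 := by rw [hu, ← pow_mul]
  have h12t : ((Real.sqrt 2)⁻¹) ^ 12 = v ^ 2 := by rw [hv, ← pow_mul]
  rw [h12s, h12t]
  nlinarith [mul_nonneg (sub_nonneg.2 hvu) (by linarith : (0 : ℝ) ≤ 2 - u - v)]

/-- `V_LJ(r) ≤ 0` for `r ≥ 47/50` (indeed for `r ≥ 2^{-1/6}`): every missing lattice bond was
attractive. [folklore] -/
theorem lennardJones_nonpos_of_ge {r : ℝ} (hr : 47 / 50 ≤ r) : lennardJones r ≤ 0 := by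
  unfold lennardJones
  have h0 : 0 < r := by linarith
  have hinv : r⁻¹ ≤ (47 / 50 : ℝ)⁻¹ := inv_anti₀ (by norm_num) hr
  have hinv0 : 0 ≤ r⁻¹ := inv_nonneg.2 h0.le
  have ht : (r⁻¹) ^ 6 ≤ ((47 / 50 : ℝ)⁻¹) ^ 6 := pow_le_pow_left₀ hinv0 hinv 6
  have h2 : ((47 / 50 : ℝ)⁻¹) ^ 6 < 2 := by norm_num
  have ht0 : 0 ≤ (r⁻¹) ^ 6 := by positivity
  have h12 : (r⁻¹) ^ 12 = ((r⁻¹) ^ 6) ^ 2 := by ring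
  rw [h12]
  nlinarith

/-- `V_LJ(√2) = −15/768`. [folklore] -/
theorem lennardJones_sqrt_two : lennardJones (Real.sqrt 2) = -(15 / 768) := by
  unfold lennardJones
  have h2 : Real.sqrt 2 ^ 2 = 2 := Real.sq_sqrt (by norm_num)
  have h6 : Real.sqrt 2 ^ 6 = 8 := by
    rw [show Real.sqrt 2 ^ 6 = (Real.sqrt 2 ^ 2) ^ 3 by ring, h2]; norm_num
  have h12 : Real.sqrt 2 ^ 12 = 64 := by
    rw [show Real.sqrt 2 ^ 12 = (Real.sqrt 2 ^ 2) ^ 6 by ring, h2]; norm_num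
  rw [inv_pow, inv_pow, h6, h12]
  norm_num

/-- `V_LJ(a) ≤ −15/768` on the window `a ∈ [47/50, 1]` (there `V_LJ(a) ≤ −0.066`). [folklore] -/
theorem lennardJones_le_of_window {a : ℝ} (h47 : 47 / 50 ≤ a) (h1 : a ≤ 1) :
    lennardJones a ≤ -(15 / 768) := by
  unfold lennardJones
  have h0 : 0 < a := by linarith
  have hinv : a⁻¹ ≤ (47 / 50 : ℝ)⁻¹ := inv_anti₀ (by norm_num) h47
  have hinv1 : 1 ≤ a⁻¹ := one_le_inv_iff₀.2 ⟨h0, h1⟩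
  have hinv0 : 0 ≤ a⁻¹ := by linarith
  have ht : (a⁻¹) ^ 6 ≤ ((47 / 50 : ℝ)⁻¹) ^ 6 := pow_le_pow_left₀ hinv0 hinv 6
  have hup : ((47 / 50 : ℝ)⁻¹) ^ 6 ≤ 29 / 20 := by norm_num
  have ht1 : 1 ≤ (a⁻¹) ^ 6 := one_le_pow₀ hinv1
  have h12 : (a⁻¹) ^ 12 = ((a⁻¹) ^ 6) ^ 2 := by ring
  rw [h12]
  nlinarith [mul_nonneg (sub_nonneg.2 ht1) (sub_nonneg.2 (ht.trans hup))]

/-- **A missing two-shell bond is worth at least `15/768`**: for a site vector on either shell,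
`V_LJ(‖cs a • intVec v‖) ≤ −15/768` (`= V(a) ≤ −0.066` or `V(√2 a) ≤ V(√2) = −15/768`).
[folklore] -/
theorem lennardJones_site_le {a : ℝ} (h47 : 47 / 50 ≤ a) (h1 : a ≤ 1) {v : Fin 3 → ℤ}
    (hv : v ∈ fccInt ∪ fccSecondShellInt) : lennardJones ‖cs a • intVec v‖ ≤ -(15 / 768) := by
  have ha : 0 < a := by linarith
  rcases norm_site ha hv with h | h
  · rw [h]; exact lennardJones_le_of_window h47 h1
  · rw [h, ← lennardJones_sqrt_two]
    exact lennardJones_sqrt_two_mul_le h47 h1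

/-- **Registered sub-goal `stub_latticeShell` of the crux item** (line `Sketch`, continuation lead
c1): a bad particle of an fcc-lattice sub-configuration has a vacant two-shell site
(`exists_vacant_site_of_bad`, quantified form). [folklore] -/
theorem stub_latticeShell :
    ∀ a : ℝ, 47 / 50 ≤ a → a ≤ 1 → ∀ (N : ℕ) (x : Fin N → EuclideanSpace ℝ (Fin 3)),
      Function.Injective x → (∀ j : Fin N, x j ∈ (fccD3 a : Set (EuclideanSpace ℝ (Fin 3)))) →
      ∀ i : Fin N, ¬ IsTwoShellGood (1 / 20) (47 / 50) 1 x i →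
      ∃ v ∈ fccInt ∪ fccSecondShellInt, x i + cs a • intVec v ∉ Set.range x :=
  fun _ h47 h1 _ _ hx hL i hbad => exists_vacant_site_of_bad h47 h1 hx hL i hbad

end Summit.AtomisticToContinuum.Crystallization.Theorems.PhononSlackCertificatesNearFarGlueR

end
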